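/-
Copyright (c) 2026 the pub-hodgecm-mathlib formalisation cell (harness21).  Prover seat hodgecm-mathlib-K2E3-p27 (g4), Track B «K2-LIT», h413 = `stmt-HodgeConjecture-24833`,
route `HCCMUnconditional`, R90-TF S8; S8 dealer R90-CS-plan (g4), #4′ U-body census f4792640bfd68b67: the socket's bytes from the PER-ROW PER-BLOCK LETTERS of every CM field
(★ p865023 T2+U-rows ∘ ★ p865199 UB-PK-1), in ONE name.
-/
import Summits.HodgeConjecture.HodgeConjecture.Theorems.R90S8ResHRowPackageOfBlockLettersU2      -- ★ p865199 (this seat) UB-PK-1: `rowBody_of_blockLetters`; brings ★ p865023 `resH_spannedByCharLines_cm_of_rows`, ★ T1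
import HarnessLib

/-!
# S8 #4′ road — `R90S8ResHSpannedByCharLinesOfBlockLettersU2`: SOCKET #4′'s EXACT BYTES FROM THE PER-ROW, PER-BLOCK LETTERS OF EVERY CM FIELD

Track B ∕ K2-LIT, crux h413 = `stmt-HodgeConjecture-24833`, route of record `HCCMUnconditional`; cell `hodgecm-mathlib`, R90-TF S8 «ContSpec-n½», socket #4′
`sock_S8_resH_spannedByCharLines` (`Lines/R90_S8_ResidualSpectrumU3B.lean` ED. 7 :494–:503).  THEOREMS ONLY (no `def`, no `instance`, no `notation`, no named-fact hypothesis, no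
`sorry`; default heartbeats); lane `--supports stmt-HodgeConjecture-24833 --as helper` (count-neutral).  CLOSES NO SOCKET.

WHY ([MoeglinWaldspurger1995, I.2.18, II.2.4, V.3.13, VI.2]; [Langlands1976, §7]).  ★ p865023 `resH_spannedByCharLines_cm_of_rows` gives the socket's bytes from the row packages
`hrows` of every CM field; ★ p865199 `rowBody_of_blockLetters` gives a row from its two per-block letters (self-dual: SOME model with (N_blk) ∧ (L); off-dual: (N_blk) for EVERY model).
Composed: **`resH_spannedByCharLines_cm_of_blockLetters (hletters)`** — #4′'s EXACT type from «for every CM field `L`, every automorphic `μ`, every row `(Kf ≤ K₀ open, ω unitary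
continuous)` of the index of record: the self-dual letter ∧ the off-dual letter at `(Kad Kf, ω)`».  This is the ONE hypothesis the H side of #4′ now owes; its known payers: off-dual letter at
`ω = 1` = ★ `hNOD_kad_of_structural` (UB-OD-1, modulo structural measures + `hVc_kad`) ∕ top ★ `hNOD_maximalLevel_of_structural`; self-dual letter at the top = ★ p865127 ∧ ★ p865055 (modulo
X1∕X2); self-dual below `K_max` = G9 rank-n package (XL); every `ω ≠ 1` row = no kit (XL).
* §1 **`resH_spannedByCharLines_cm_of_blockLetters`** — socket #4′'s bytes from the per-row per-block letters (★ p865023 ∘ ★ p865199).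
HONEST LABEL: HC_CM is proved only modulo the 7 printed citations (2 remaining named inputs: hLiu418 = `stmt-HodgeConjecture-24832`, h413 = `stmt-HodgeConjecture-24833`) until rung 0
closes; REL ≠ ★ ≠ BUILT; this file asserts no named fact, is conditional by construction on the letters, and closes no socket (#4′ OPEN); count-neutral.

## References
* [MoeglinWaldspurger1995] C. Mœglin, J.-L. Waldspurger, *Spectral Decomposition and Eisenstein Series* (1995), I.2.18, II.2.4, V.3.13, VI.2.
* [Langlands1976] R. P. Langlands, *On the Functional Equations Satisfied by Eisenstein Series*, SLN 544 (1976), §7.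
-/

set_option autoImplicit false
set_option linter.dupNamespace false  -- the mandated namespace `…HodgeConjecture.HodgeConjecture.R90.S8` (LEAD #1 L1) repeats the summit's segment

noncomputable section

open MeasureTheory Measure Set Filter Topology NumberField NumberField.mixedEmbedding IsDedekindDomain
open Literature.MeasureTheory.Group Literature.NumberTheory.Automorphic Literature.NumberTheory.Automorphic.UnitaryGroup Literature.NumberTheory.GaloisRepresentations AdelicGroupData ContRepresentation
open Literature.NumberTheory.Automorphic.Arthur2013.Leaves.TECR
open Summit.HodgeConjecture.HodgeConjecture.Cruxes.H413.K2E1BorelEisensteinU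
open Summit.HodgeConjecture.HodgeConjecture.Cruxes.H413.K2E1CharacterEisensteinU2Defs
open Summit.HodgeConjecture.HodgeConjecture.Cruxes.H413.K2E1ChiSectionSpaceU2Defs
open Summit.HodgeConjecture.HodgeConjecture.Cruxes.H413.K2E1CuspidalSpectrumUnitary (residualSubspace cmResidualSubspaceR)
open Summit.HodgeConjecture.HodgeConjecture.Cruxes.H413.R90S8ResidualDefs (charLine₂)
open scoped ENNReal NNReal Pointwise

namespace Summit.HodgeConjecture.HodgeConjecture.R90.S8

/-! ## §1 Socket #4′ from the per-row per-block letters -/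

/-- **SOCKET #4′ FROM THE PER-ROW, PER-BLOCK LETTERS OF EVERY CM FIELD.**  Hypothesis `hletters`: for every CM field `L`, every automorphic measure `μ` on the quotient of `U(J₂)_{L∕L⁺}`,
every open finite level `Kf ≤ K₀` and every unitary continuous character `ω` of `Kad Kf`: (SD) every self-dual block `b` of `S_ω(Kad Kf)` carries SOME model `V : L² →ₗ A × Λ` with
`W′ ⊓ Iso(Kad Kf, ω) ≤ (resHLine V)ᗮ` for all irreducible closed `W′` and `resHAtom V ≤ ⨆_ψ ℂ·[ψ∘det]`; (OD) every off-dual block carries the (N_blk) clause for EVERY model.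
Conclusion: socket #4′'s EXACT bytes (`Lines/R90_S8_ResidualSpectrumU3B.lean` :495–:502).  Proof: ★ p865023 `resH_spannedByCharLines_cm_of_rows` ∘ ★ p865199 `rowBody_of_blockLetters`.
[cite: MoeglinWaldspurger1995, I.2.18, II.2.4, V.3.13, VI.2] [cite: Langlands1976, §7] -/
theorem resH_spannedByCharLines_cm_of_blockLetters
    (hletters : ∀ (L : Type) [Field L] [NumberField L] [IsCMField L]
      (μ : Measure (quasiSplit (↥(maximalRealSubfield L)) L (IsCMField.complexConj L) 2).automorphicQuotient) [(quasiSplit (↥(maximalRealSubfield L)) L (IsCMField.complexConj L) 2).IsAutomorphicMeasure μ],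
      ∀ (Kf : Subgroup ↥(finAdelic (↥(maximalRealSubfield L)) L (IsCMField.complexConj L) 2 ((StdForm.antidiagonal 2).over L))), IsOpen ((Kf : Subgroup ↥(finAdelic (↥(maximalRealSubfield L)) L (IsCMField.complexConj L) 2 ((StdForm.antidiagonal 2).over L))) : Set ↥(finAdelic (↥(maximalRealSubfield L)) L (IsCMField.complexConj L) 2 ((StdForm.antidiagonal 2).over L))) → Kf ≤ ((((standardMaximalCompactGL 2 L).comap (adelicVal (↥(maximalRealSubfield L)) L (IsCMField.complexConj L) 2 ((StdForm.antidiagonal 2).over L)) : Subgroup (quasiSplit (↥(maximalRealSubfield L)) L (IsCMField.complexConj L) 2).Adelic)).comap (finAdelicToAdelic (↥(maximalRealSubfield L)) L (IsCMField.complexConj L) 2 ((StdForm.antidiagonal 2).over L)) : Subgroup ↥(finAdelic (↥(maximalRealSubfield L)) L (IsCMField.complexConj L) 2 ((StdForm.antidiagonal 2).over L))) →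
        ∀ (ω : ↥(Subgroup.closure ((Set.range (fun k : ↥(UnitaryGroup.arch (↥(maximalRealSubfield L)) L (IsCMField.complexConj L) 2 ((StdForm.antidiagonal 2).over L) ⊓ unitaryGroupOfForm (conjMixed (↥(maximalRealSubfield L)) L (IsCMField.complexConj L)) 1) => (archToAdelic (↥(maximalRealSubfield L)) L (IsCMField.complexConj L) 2 ((StdForm.antidiagonal 2).over L)) (Subgroup.inclusion inf_le_left k)) ∪
            (finAdelicToAdelic (↥(maximalRealSubfield L)) L (IsCMField.complexConj L) 2 ((StdForm.antidiagonal 2).over L)) '' ((Kf : Subgroup ↥(finAdelic (↥(maximalRealSubfield L)) L (IsCMField.complexConj L) 2 ((StdForm.antidiagonal 2).over L))) : Set ↥(finAdelic (↥(maximalRealSubfield L)) L (IsCMField.complexConj L) 2 ((StdForm.antidiagonal 2).over L)))) : Set (quasiSplit (↥(maximalRealSubfield L)) L (IsCMField.complexConj L) 2).Adelic)) →* ℂ), (∀ x, ‖ω x‖ = 1) → Continuous ω →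
        (∀ b : ↥{χ : HeckeCharacter L | (∀ r : ℝ≥0ˣ, χ (posRealIdele L r) = 1) ∧ chiSectionSpace χ (Subgroup.closure ((Set.range (fun k : ↥(UnitaryGroup.arch (↥(maximalRealSubfield L)) L (IsCMField.complexConj L) 2 ((StdForm.antidiagonal 2).over L) ⊓ unitaryGroupOfForm (conjMixed (↥(maximalRealSubfield L)) L (IsCMField.complexConj L)) 1) => (archToAdelic (↥(maximalRealSubfield L)) L (IsCMField.complexConj L) 2 ((StdForm.antidiagonal 2).over L)) (Subgroup.inclusion inf_le_left k)) ∪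
            (finAdelicToAdelic (↥(maximalRealSubfield L)) L (IsCMField.complexConj L) 2 ((StdForm.antidiagonal 2).over L)) '' ((Kf : Subgroup ↥(finAdelic (↥(maximalRealSubfield L)) L (IsCMField.complexConj L) 2 ((StdForm.antidiagonal 2).over L))) : Set ↥(finAdelic (↥(maximalRealSubfield L)) L (IsCMField.complexConj L) 2 ((StdForm.antidiagonal 2).over L)))) : Set (quasiSplit (↥(maximalRealSubfield L)) L (IsCMField.complexConj L) 2).Adelic)) ((ω) : ↥(Subgroup.closure ((Set.range (fun k : ↥(UnitaryGroup.arch (↥(maximalRealSubfield L)) L (IsCMField.complexConj L) 2 ((StdForm.antidiagonal 2).over L) ⊓ unitaryGroupOfForm (conjMixed (↥(maximalRealSubfield L)) L (IsCMField.complexConj L)) 1) => (archToAdelic (↥(maximalRealSubfield L)) L (IsCMField.complexConj L) 2 ((StdForm.antidiagonal 2).over L)) (Subgroup.inclusion inf_le_left k)) ∪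
            (finAdelicToAdelic (↥(maximalRealSubfield L)) L (IsCMField.complexConj L) 2 ((StdForm.antidiagonal 2).over L)) '' ((Kf : Subgroup ↥(finAdelic (↥(maximalRealSubfield L)) L (IsCMField.complexConj L) 2 ((StdForm.antidiagonal 2).over L))) : Set ↥(finAdelic (↥(maximalRealSubfield L)) L (IsCMField.complexConj L) 2 ((StdForm.antidiagonal 2).over L)))) : Set (quasiSplit (↥(maximalRealSubfield L)) L (IsCMField.complexConj L) 2).Adelic)) → ℂ) ≠ ⊥}, reflectChar (IsCMField.complexConj L) (b : HeckeCharacter L) = (b : HeckeCharacter L) →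
          ∃ (A Λ : Type) (_ : AddCommGroup A) (_ : Module ℂ A) (_ : AddCommGroup Λ) (_ : Module ℂ Λ) (V : (quasiSplit (↥(maximalRealSubfield L)) L (IsCMField.complexConj L) 2).L2 μ →ₗ[ℂ] A × Λ),
            (∀ (W' : ClosedSubrep ((quasiSplit (↥(maximalRealSubfield L)) L (IsCMField.complexConj L) 2).rightRegular μ)), W'.toContRep.IsTopIrreducible →
          W'.toSubmodule ⊓ (⨅ k : ↥(Subgroup.closure ((Set.range (fun k : ↥(UnitaryGroup.arch (↥(maximalRealSubfield L)) L (IsCMField.complexConj L) 2 ((StdForm.antidiagonal 2).over L) ⊓ unitaryGroupOfForm (conjMixed (↥(maximalRealSubfield L)) L (IsCMField.complexConj L)) 1) => (archToAdelic (↥(maximalRealSubfield L)) L (IsCMField.complexConj L) 2 ((StdForm.antidiagonal 2).over L)) (Subgroup.inclusion inf_le_left k)) ∪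
            (finAdelicToAdelic (↥(maximalRealSubfield L)) L (IsCMField.complexConj L) 2 ((StdForm.antidiagonal 2).over L)) '' ((Kf : Subgroup ↥(finAdelic (↥(maximalRealSubfield L)) L (IsCMField.complexConj L) 2 ((StdForm.antidiagonal 2).over L))) : Set ↥(finAdelic (↥(maximalRealSubfield L)) L (IsCMField.complexConj L) 2 ((StdForm.antidiagonal 2).over L)))) : Set (quasiSplit (↥(maximalRealSubfield L)) L (IsCMField.complexConj L) 2).Adelic)), Module.End.eigenspace ((((quasiSplit (↥(maximalRealSubfield L)) L (IsCMField.complexConj L) 2).rightRegular μ) ((Subgroup.closure ((Set.range (fun k : ↥(UnitaryGroup.arch (↥(maximalRealSubfield L)) L (IsCMField.complexConj L) 2 ((StdForm.antidiagonal 2).over L) ⊓ unitaryGroupOfForm (conjMixed (↥(maximalRealSubfield L)) L (IsCMField.complexConj L)) 1) => (archToAdelic (↥(maximalRealSubfield L)) L (IsCMField.complexConj L) 2 ((StdForm.antidiagonal 2).over L)) (Subgroup.inclusion inf_le_left k)) ∪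
            (finAdelicToAdelic (↥(maximalRealSubfield L)) L (IsCMField.complexConj L) 2 ((StdForm.antidiagonal 2).over L)) '' ((Kf : Subgroup ↥(finAdelic (↥(maximalRealSubfield L)) L (IsCMField.complexConj L) 2 ((StdForm.antidiagonal 2).over L))) : Set ↥(finAdelic (↥(maximalRealSubfield L)) L (IsCMField.complexConj L) 2 ((StdForm.antidiagonal 2).over L)))) : Set (quasiSplit (↥(maximalRealSubfield L)) L (IsCMField.complexConj L) 2).Adelic)).subtype k) : (quasiSplit (↥(maximalRealSubfield L)) L (IsCMField.complexConj L) 2).L2 μ →L[ℂ] (quasiSplit (↥(maximalRealSubfield L)) L (IsCMField.complexConj L) 2).L2 μ) :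
          (quasiSplit (↥(maximalRealSubfield L)) L (IsCMField.complexConj L) 2).L2 μ →ₗ[ℂ] (quasiSplit (↥(maximalRealSubfield L)) L (IsCMField.complexConj L) 2).L2 μ) ((ω) k)) ≤ (resHLine L μ (V) (Subgroup.closure ((Set.range (fun k : ↥(UnitaryGroup.arch (↥(maximalRealSubfield L)) L (IsCMField.complexConj L) 2 ((StdForm.antidiagonal 2).over L) ⊓ unitaryGroupOfForm (conjMixed (↥(maximalRealSubfield L)) L (IsCMField.complexConj L)) 1) => (archToAdelic (↥(maximalRealSubfield L)) L (IsCMField.complexConj L) 2 ((StdForm.antidiagonal 2).over L)) (Subgroup.inclusion inf_le_left k)) ∪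
            (finAdelicToAdelic (↥(maximalRealSubfield L)) L (IsCMField.complexConj L) 2 ((StdForm.antidiagonal 2).over L)) '' ((Kf : Subgroup ↥(finAdelic (↥(maximalRealSubfield L)) L (IsCMField.complexConj L) 2 ((StdForm.antidiagonal 2).over L))) : Set ↥(finAdelic (↥(maximalRealSubfield L)) L (IsCMField.complexConj L) 2 ((StdForm.antidiagonal 2).over L)))) : Set (quasiSplit (↥(maximalRealSubfield L)) L (IsCMField.complexConj L) 2).Adelic)) ω (b : HeckeCharacter L))ᗮ) ∧
            resHAtom L μ (V) (Subgroup.closure ((Set.range (fun k : ↥(UnitaryGroup.arch (↥(maximalRealSubfield L)) L (IsCMField.complexConj L) 2 ((StdForm.antidiagonal 2).over L) ⊓ unitaryGroupOfForm (conjMixed (↥(maximalRealSubfield L)) L (IsCMField.complexConj L)) 1) => (archToAdelic (↥(maximalRealSubfield L)) L (IsCMField.complexConj L) 2 ((StdForm.antidiagonal 2).over L)) (Subgroup.inclusion inf_le_left k)) ∪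
            (finAdelicToAdelic (↥(maximalRealSubfield L)) L (IsCMField.complexConj L) 2 ((StdForm.antidiagonal 2).over L)) '' ((Kf : Subgroup ↥(finAdelic (↥(maximalRealSubfield L)) L (IsCMField.complexConj L) 2 ((StdForm.antidiagonal 2).over L))) : Set ↥(finAdelic (↥(maximalRealSubfield L)) L (IsCMField.complexConj L) 2 ((StdForm.antidiagonal 2).over L)))) : Set (quasiSplit (↥(maximalRealSubfield L)) L (IsCMField.complexConj L) 2).Adelic)) ω (b : HeckeCharacter L) ≤ (⨆ ψ : {ψ : ↥(TorusDict.torus (IsCMField.complexConj L)) →ₜ* ℂˣ // TorusDict.IsAutomorphic (IsCMField.complexConj L) ψ},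
        (AdelicGroupData.AutomorphicCharacter.lineSubrep (𝒢 := (quasiSplit (↥(maximalRealSubfield L)) L (IsCMField.complexConj L) 2))
          (cmDetChar L 2 ((StdForm.antidiagonal 2).over L) ψ.1 ψ.2 ((Matrix.isUnit_iff_isUnit_det _).mp (StdForm.isUnit_over (StdForm.antidiagonal 2) L)).ne_zero) μ).toSubmodule)) ∧
        (∀ b : ↥{χ : HeckeCharacter L | (∀ r : ℝ≥0ˣ, χ (posRealIdele L r) = 1) ∧ chiSectionSpace χ (Subgroup.closure ((Set.range (fun k : ↥(UnitaryGroup.arch (↥(maximalRealSubfield L)) L (IsCMField.complexConj L) 2 ((StdForm.antidiagonal 2).over L) ⊓ unitaryGroupOfForm (conjMixed (↥(maximalRealSubfield L)) L (IsCMField.complexConj L)) 1) => (archToAdelic (↥(maximalRealSubfield L)) L (IsCMField.complexConj L) 2 ((StdForm.antidiagonal 2).over L)) (Subgroup.inclusion inf_le_left k)) ∪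
            (finAdelicToAdelic (↥(maximalRealSubfield L)) L (IsCMField.complexConj L) 2 ((StdForm.antidiagonal 2).over L)) '' ((Kf : Subgroup ↥(finAdelic (↥(maximalRealSubfield L)) L (IsCMField.complexConj L) 2 ((StdForm.antidiagonal 2).over L))) : Set ↥(finAdelic (↥(maximalRealSubfield L)) L (IsCMField.complexConj L) 2 ((StdForm.antidiagonal 2).over L)))) : Set (quasiSplit (↥(maximalRealSubfield L)) L (IsCMField.complexConj L) 2).Adelic)) ((ω) : ↥(Subgroup.closure ((Set.range (fun k : ↥(UnitaryGroup.arch (↥(maximalRealSubfield L)) L (IsCMField.complexConj L) 2 ((StdForm.antidiagonal 2).over L) ⊓ unitaryGroupOfForm (conjMixed (↥(maximalRealSubfield L)) L (IsCMField.complexConj L)) 1) => (archToAdelic (↥(maximalRealSubfield L)) L (IsCMField.complexConj L) 2 ((StdForm.antidiagonal 2).over L)) (Subgroup.inclusion inf_le_left k)) ∪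
            (finAdelicToAdelic (↥(maximalRealSubfield L)) L (IsCMField.complexConj L) 2 ((StdForm.antidiagonal 2).over L)) '' ((Kf : Subgroup ↥(finAdelic (↥(maximalRealSubfield L)) L (IsCMField.complexConj L) 2 ((StdForm.antidiagonal 2).over L))) : Set ↥(finAdelic (↥(maximalRealSubfield L)) L (IsCMField.complexConj L) 2 ((StdForm.antidiagonal 2).over L)))) : Set (quasiSplit (↥(maximalRealSubfield L)) L (IsCMField.complexConj L) 2).Adelic)) → ℂ) ≠ ⊥}, reflectChar (IsCMField.complexConj L) (b : HeckeCharacter L) ≠ (b : HeckeCharacter L) →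
          ∀ (A Λ : Type) [AddCommGroup A] [Module ℂ A] [AddCommGroup Λ] [Module ℂ Λ] (U' : (quasiSplit (↥(maximalRealSubfield L)) L (IsCMField.complexConj L) 2).L2 μ →ₗ[ℂ] A × Λ),
            ∀ (W' : ClosedSubrep ((quasiSplit (↥(maximalRealSubfield L)) L (IsCMField.complexConj L) 2).rightRegular μ)), W'.toContRep.IsTopIrreducible →
          W'.toSubmodule ⊓ (⨅ k : ↥(Subgroup.closure ((Set.range (fun k : ↥(UnitaryGroup.arch (↥(maximalRealSubfield L)) L (IsCMField.complexConj L) 2 ((StdForm.antidiagonal 2).over L) ⊓ unitaryGroupOfForm (conjMixed (↥(maximalRealSubfield L)) L (IsCMField.complexConj L)) 1) => (archToAdelic (↥(maximalRealSubfield L)) L (IsCMField.complexConj L) 2 ((StdForm.antidiagonal 2).over L)) (Subgroup.inclusion inf_le_left k)) ∪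
            (finAdelicToAdelic (↥(maximalRealSubfield L)) L (IsCMField.complexConj L) 2 ((StdForm.antidiagonal 2).over L)) '' ((Kf : Subgroup ↥(finAdelic (↥(maximalRealSubfield L)) L (IsCMField.complexConj L) 2 ((StdForm.antidiagonal 2).over L))) : Set ↥(finAdelic (↥(maximalRealSubfield L)) L (IsCMField.complexConj L) 2 ((StdForm.antidiagonal 2).over L)))) : Set (quasiSplit (↥(maximalRealSubfield L)) L (IsCMField.complexConj L) 2).Adelic)), Module.End.eigenspace ((((quasiSplit (↥(maximalRealSubfield L)) L (IsCMField.complexConj L) 2).rightRegular μ) ((Subgroup.closure ((Set.range (fun k : ↥(UnitaryGroup.arch (↥(maximalRealSubfield L)) L (IsCMField.complexConj L) 2 ((StdForm.antidiagonal 2).over L) ⊓ unitaryGroupOfForm (conjMixed (↥(maximalRealSubfield L)) L (IsCMField.complexConj L)) 1) => (archToAdelic (↥(maximalRealSubfield L)) L (IsCMField.complexConj L) 2 ((StdForm.antidiagonal 2).over L)) (Subgroup.inclusion inf_le_left k)) ∪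
            (finAdelicToAdelic (↥(maximalRealSubfield L)) L (IsCMField.complexConj L) 2 ((StdForm.antidiagonal 2).over L)) '' ((Kf : Subgroup ↥(finAdelic (↥(maximalRealSubfield L)) L (IsCMField.complexConj L) 2 ((StdForm.antidiagonal 2).over L))) : Set ↥(finAdelic (↥(maximalRealSubfield L)) L (IsCMField.complexConj L) 2 ((StdForm.antidiagonal 2).over L)))) : Set (quasiSplit (↥(maximalRealSubfield L)) L (IsCMField.complexConj L) 2).Adelic)).subtype k) : (quasiSplit (↥(maximalRealSubfield L)) L (IsCMField.complexConj L) 2).L2 μ →L[ℂ] (quasiSplit (↥(maximalRealSubfield L)) L (IsCMField.complexConj L) 2).L2 μ) :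
          (quasiSplit (↥(maximalRealSubfield L)) L (IsCMField.complexConj L) 2).L2 μ →ₗ[ℂ] (quasiSplit (↥(maximalRealSubfield L)) L (IsCMField.complexConj L) 2).L2 μ) ((ω) k)) ≤ (resHLine L μ (U') (Subgroup.closure ((Set.range (fun k : ↥(UnitaryGroup.arch (↥(maximalRealSubfield L)) L (IsCMField.complexConj L) 2 ((StdForm.antidiagonal 2).over L) ⊓ unitaryGroupOfForm (conjMixed (↥(maximalRealSubfield L)) L (IsCMField.complexConj L)) 1) => (archToAdelic (↥(maximalRealSubfield L)) L (IsCMField.complexConj L) 2 ((StdForm.antidiagonal 2).over L)) (Subgroup.inclusion inf_le_left k)) ∪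
            (finAdelicToAdelic (↥(maximalRealSubfield L)) L (IsCMField.complexConj L) 2 ((StdForm.antidiagonal 2).over L)) '' ((Kf : Subgroup ↥(finAdelic (↥(maximalRealSubfield L)) L (IsCMField.complexConj L) 2 ((StdForm.antidiagonal 2).over L))) : Set ↥(finAdelic (↥(maximalRealSubfield L)) L (IsCMField.complexConj L) 2 ((StdForm.antidiagonal 2).over L)))) : Set (quasiSplit (↥(maximalRealSubfield L)) L (IsCMField.complexConj L) 2).Adelic)) ω (b : HeckeCharacter L))ᗮ)) :
    ∀ (L : Type) [Field L] [NumberField L] [IsCMField L]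
      (μ₂ : Measure (UnitaryGroup.cmDatum L 2 (Matrix.of fun i j : Fin 2 => if i.val + j.val + 1 = 2 then (1 : L) else 0)).automorphicQuotient)
      [(UnitaryGroup.cmDatum L 2 (Matrix.of fun i j : Fin 2 => if i.val + j.val + 1 = 2 then (1 : L) else 0)).IsAutomorphicMeasure μ₂]
      (P : DiscreteAutomorphicRep (UnitaryGroup.cmDatum L 2 (Matrix.of fun i j : Fin 2 => if i.val + j.val + 1 = 2 then (1 : L) else 0)) μ₂),
      P.space ≤ cmResidualSubspaceR L 2 μ₂ →
      P.space.toSubmodule ≤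
        (⨆ ψ : {ψ : ↥(TorusDict.torus (IsCMField.complexConj L)) →ₜ* ℂˣ // TorusDict.IsAutomorphic (IsCMField.complexConj L) ψ},
            (charLine₂ L ψ.1 ψ.2 μ₂).toSubmodule).topologicalClosure :=
  resH_spannedByCharLines_cm_of_rows fun L _ _ _ μ _ Kf hKo hKle ω hω1 hωc =>
    rowBody_of_blockLetters L μ Kf ω (hletters L μ Kf hKo hKle ω hω1 hωc).1 (hletters L μ Kf hKo hKle ω hω1 hωc).2

end Summit.HodgeConjecture.HodgeConjecture.R90.S8

end
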